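/-
Copyright (c) 2026 the pub-hodgecm-mathlib formalisation cell (harness21).  Prover seat hodgecm-mathlib-LH4-p07 (g8), req620 Track A «(D-RAM) FOUR-FRAME» squad
(STAGE-1b pre-scoping, heir LEAD F0P3a-plan (g20) T19-24 clause; dealer LH4-plan (g12) STATUS #18 ∕ WORD #36 «p07 (g8): row-(2) lead»), 2026-09-04.
-/
import Summits.HodgeConjecture.HodgeConjecture.Theorems.F0P3cDyRamBlockGlueLevelCount   -- ★ p858811 (this seat): (C1-P) part 1 (the depth token); brings ★ p858757 (E1), ★ p857501∕p857479 (g6), ★ p857312, ★ (z1-d)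
import HarnessLib

/-!
# Crux `H413`, line LH4 «(D-RAM) FOUR-FRAME» — STAGE-1b, row (2): organ (C1-P^X) part 1 «O-GLUE COUNT WITH A GENERIC BLOCK TOKEN»
# `#{M ∣ SD, Γ·M = M, X·M ⊆ c·M} = #{B₂ ∣ SD_W, γ₂B₂ = B₂, c⁻¹X_W·B₂ ⊆ B₂} + Σ_{b=1}^{R} Σᶠ_{B₂ ∈ S_b^{X,c}(γ₂, u)} #fibre(ι_W B₂, b)`

Cell `hodgecm-mathlib` (D-0151), FLOOR 0, crux item H413 = `stmt-HodgeConjecture-24833`, route of record `HCCMUnconditional`; squad F0∕P3c∕LH4; lane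
`--supports stmt-HodgeConjecture-24833 --as helper` (count-neutral; pays NO tier-0 row).  THEOREMS ONLY (no `def`, no instance, no notation, no `sorry`).  DATUM-FREE
(`K` valued, `𝒪[K]` a PID, `σ` an isometric involution, `|ϖ| = exp(−1)`, block form with `H₂` hermitian of unit determinant, `|h| = 1`).

WHAT THIS IS.  ★ p858811 cut the index sets of ★ p857501 (this lineage g6: `#F = #axis + Σ_b Σᶠ_{S_b} #fibre`) by the DEPTH token `(Γ − 1)·M ⊆ c·M`.  Here the token is a
GENERIC BLOCK-AT-1 MATRIX `X` (column `1` = `X₁₁e₁`, row `1` zero off the diagonal; `X_W = !![X₀₀, X₀₂; X₂₀, X₂₂]` its compression): `X·M ⊆ c·M`, `c ≠ 0`, guard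
`|X₁₁| ≤ |c|` — covering the SQUARE token `X = (Γ − 1)²` of the pieces `sqLevel_b`, `f_reg = 1_K − sqLevel_{m*}` (★ p858649) and any polynomial token.  By ★ (E1)
`forall_mulVec_mem_scaleLattice_iff_plane` the token is a CELL-CONSTANT function of the plane glue data `(B₂, w₀)`: `|X₁₁| ≤ |c| ∧ c⁻¹X_W·B₂ ⊆ B₂ ∧ c⁻¹(X_W w₀ − X₁₁w₀) ∈ B₂`;
the cut index set `S_b^{X,c}` keeps ★ p857377's plain depth clause `γ₂w₀ − u·w₀ ∈ B₂` (for a generic `X` the token does not imply it) and ADDS the two `X`-clauses; fibres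
and ★ T2b's norm-residue weights are UNCHANGED.
* §0 a block-at-1 matrix IS `ι`-shaped; the token at an axis lattice `latt ι(g₂, 1)` splits into its `W`-block and `|X₁₁| ≤ |c|` (★ `map_toLin'_latt_le_scaleLattice_iff`,
  ★ `endoShape_mul_endoShape`, ★ `inv_endoShape`, ★ `forall_v_endoShape_le_iff` — the generic twin of ★ `map_endoGL_sub_one(_sq)_latt_endoGL_le_scaleLattice_iff`).
* §1 (L5-X)∕(L6-X): cut cone index set; §2 layer count; §3 HEAD (★ p857312 general side condition ⊕ ★ (z1-d) `ncard_selfDual_fixed_axis_eq` with the token label ⊕ §2).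
Part 2 (M-letters, with a line multiplier `ξ`, `φ(X_W y) = ξ·φ y`) is the sequel.
HONEST LABEL.  Count-neutral lattice bookkeeping; nothing printed is asserted; no census law is stated; `HC_CM` is proved only modulo the 7 printed citations (2 remaining named
inputs: hLiu418 = `stmt-HodgeConjecture-24832`, h413 = `stmt-HodgeConjecture-24833`) until rung 0 closes.

## References
* [BruhatTits1972] F. Bruhat, J. Tits, *Groupes réductifs sur un corps local I*, Publ. Math. IHÉS 41 (1972), §10.
* [Kottwitz1986BaseChangeUnits] R. E. Kottwitz, *Base change for unit elements of Hecke algebras*, Compositio Math. 60 (1986), §1 pp. 240–241.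
* [Jacobowitz1962] R. Jacobowitz, *Hermitian forms over local fields*, Amer. J. Math. 84 (1962), §4.
* [Rogawski1990] J. D. Rogawski, *Automorphic Representations of Unitary Groups in Three Variables*, Ann. of Math. Stud. 123 (1990), §4.8 Case (a) p. 53, §4.9 p. 55.
-/

set_option autoImplicit false

noncomputable section

namespace Summit.HodgeConjecture.HodgeConjecture.Cruxes.H413.F0P3cDyRamBlockGlueTokenCount

open scoped Valued WithZero Matrix MatrixGroups
open Literature.NumberTheory.Automorphic Literature.NumberTheory.Automorphic.HermitianLattice Literature.NumberTheory.Automorphic.UnitaryLatticeTree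
open Literature.NumberTheory.Rogawski1990
open Summit.HodgeConjecture.HodgeConjecture.Cruxes.H413.F0P3cDyRamBlockGluePlane
open Summit.HodgeConjecture.HodgeConjecture.Cruxes.H413.F0P3cDyRamBlockGlueCount
open Summit.HodgeConjecture.HodgeConjecture.Cruxes.H413.F0P3cDyRamBlockGlueLevelCount

variable {K : Type*} [Field K] [Valued K ℤᵐ⁰]

/-! ## §0 Block-at-1 matrices are `ι`-shaped; the token at an axis lattice -/

omit [Valued K ℤᵐ⁰] in
/-- A block-at-1 matrix is the `ι`-shaped matrix of its compression and its middle entry. [cite: Rogawski1990, §4.8 Case (a) p. 53] -/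
theorem eq_endoShape_of_block {X : Matrix (Fin 3) (Fin 3) K} (hcol : ∀ l, l ≠ 1 → X l 1 = 0) (hrow : ∀ l, l ≠ 1 → X 1 l = 0) :
    X = !![(!![X 0 0, X 0 2; X 2 0, X 2 2] : Matrix (Fin 2) (Fin 2) K) 0 0, 0, (!![X 0 0, X 0 2; X 2 0, X 2 2] : Matrix (Fin 2) (Fin 2) K) 0 1;
      0, X 1 1, 0; (!![X 0 0, X 0 2; X 2 0, X 2 2] : Matrix (Fin 2) (Fin 2) K) 1 0, 0, (!![X 0 0, X 0 2; X 2 0, X 2 2] : Matrix (Fin 2) (Fin 2) K) 1 1] := by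
  have h01 := hrow 0 (by decide); have h21 := hrow 2 (by decide)
  have h10 := hcol 0 (by decide); have h12 := hcol 2 (by decide)
  ext i j; fin_cases i <;> fin_cases j <;> simp [h01, h21, h10, h12]

/-- **THE TOKEN AT AN AXIS LATTICE**: for a block-at-1 `X` and `c ≠ 0`, `X·latt ι(g₂, 1) ⊆ c·latt ι(g₂, 1) ⟺ X_W·latt g₂ ⊆ c·latt g₂ ∧ |X₁₁| ≤ |c|` (the generic twin of ★
`map_endoGL_sub_one_latt_endoGL_le_scaleLattice_iff` ∕ `…_sq_…`). [cite: BruhatTits1972, §10] [cite: Rogawski1990, §4.8 Case (a) p. 53] -/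
theorem map_block_latt_endoGL_le_scaleLattice_iff {c : K} (hc : c ≠ 0) (g₂ : GL (Fin 2) K) {X : Matrix (Fin 3) (Fin 3) K}
    (hcol : ∀ l, l ≠ 1 → X l 1 = 0) (hrow : ∀ l, l ≠ 1 → X 1 l = 0) :
    (latt ((endoGL (g₂, (1 : GL (Fin 1) K)) : GL (Fin 3) K) : Matrix (Fin 3) (Fin 3) K)).map ((Matrix.toLin' X).restrictScalars 𝒪[K]) ≤
        scaleLattice c (latt ((endoGL (g₂, (1 : GL (Fin 1) K)) : GL (Fin 3) K) : Matrix (Fin 3) (Fin 3) K)) ↔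
      (latt (g₂ : Matrix (Fin 2) (Fin 2) K)).map ((Matrix.toLin' (!![X 0 0, X 0 2; X 2 0, X 2 2] : Matrix (Fin 2) (Fin 2) K)).restrictScalars 𝒪[K]) ≤
          scaleLattice c (latt (g₂ : Matrix (Fin 2) (Fin 2) K)) ∧ Valued.v (X 1 1) ≤ Valued.v c := by
  have hG : IsUnit ((((endoGL (g₂, (1 : GL (Fin 1) K)) : GL (Fin 3) K) : Matrix (Fin 3) (Fin 3) K)).det) := Matrix.isUnits_det_units _
  have hg : IsUnit ((g₂ : Matrix (Fin 2) (Fin 2) K)).det := Matrix.isUnits_det_units _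
  rw [map_toLin'_latt_le_scaleLattice_iff hc _ hG, map_toLin'_latt_le_scaleLattice_iff hc _ hg]
  set a : Matrix (Fin 2) (Fin 2) K := !![X 0 0, X 0 2; X 2 0, X 2 2] with ha
  have hX : X = !![a 0 0, 0, a 0 1; 0, X 1 1, 0; a 1 0, 0, a 1 1] := eq_endoShape_of_block hcol hrow
  have hGm : ((endoGL (g₂, (1 : GL (Fin 1) K)) : GL (Fin 3) K) : Matrix (Fin 3) (Fin 3) K) =
      !![(g₂ : Matrix (Fin 2) (Fin 2) K) 0 0, 0, (g₂ : Matrix (Fin 2) (Fin 2) K) 0 1; 0, 1, 0; (g₂ : Matrix (Fin 2) (Fin 2) K) 1 0, 0, (g₂ : Matrix (Fin 2) (Fin 2) K) 1 1] := by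
    rw [coe_endoGL_eq_endoShape, Units.val_one, Matrix.one_apply_eq]
  have hGi : ((endoGL (g₂, (1 : GL (Fin 1) K)) : GL (Fin 3) K) : Matrix (Fin 3) (Fin 3) K)⁻¹ =
      !![(g₂ : Matrix (Fin 2) (Fin 2) K)⁻¹ 0 0, 0, (g₂ : Matrix (Fin 2) (Fin 2) K)⁻¹ 0 1; 0, (1 : K)⁻¹, 0;
        (g₂ : Matrix (Fin 2) (Fin 2) K)⁻¹ 1 0, 0, (g₂ : Matrix (Fin 2) (Fin 2) K)⁻¹ 1 1] := by
    rw [hGm, inv_endoShape hg one_ne_zero]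
  have hconj : ((endoGL (g₂, (1 : GL (Fin 1) K)) : GL (Fin 3) K) : Matrix (Fin 3) (Fin 3) K)⁻¹ * X *
      ((endoGL (g₂, (1 : GL (Fin 1) K)) : GL (Fin 3) K) : Matrix (Fin 3) (Fin 3) K) =
      !![((g₂ : Matrix (Fin 2) (Fin 2) K)⁻¹ * a * (g₂ : Matrix (Fin 2) (Fin 2) K)) 0 0, 0, ((g₂ : Matrix (Fin 2) (Fin 2) K)⁻¹ * a * (g₂ : Matrix (Fin 2) (Fin 2) K)) 0 1;
        0, X 1 1, 0;
        ((g₂ : Matrix (Fin 2) (Fin 2) K)⁻¹ * a * (g₂ : Matrix (Fin 2) (Fin 2) K)) 1 0, 0, ((g₂ : Matrix (Fin 2) (Fin 2) K)⁻¹ * a * (g₂ : Matrix (Fin 2) (Fin 2) K)) 1 1] := by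
    rw [hGi, hX, endoShape_mul_endoShape, hGm, endoShape_mul_endoShape, inv_one, one_mul, mul_one]
    ext i j; fin_cases i <;> fin_cases j <;> simp
  rw [hconj, forall_v_endoShape_le_iff]

/-! ## §1 (L5-X)∕(L6-X): the cut cone index set `S_b^{X,c}` -/

/-- **(L5-X)** If `M` is self-dual with tube coordinate `b ≥ 1`, `Γ·M = M` (`Γ = ι(γ₂, u)` unitary, `|u| = 1`) and `X·M ⊆ c·M` (`X` block at `1`, `c ≠ 0`), then `ι_W⁻¹(M ∩ W)`
lies in `S_b^{X,c}`: ★ p857377's clauses (with the plain depth clause) PLUS `c⁻¹X_W·B ⊆ B` and `c⁻¹(X_W w₀ − X₁₁w₀) ∈ B` (★ p857479 §2 + ★ (L5) + ★ (E1)).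
[cite: Kottwitz1986BaseChangeUnits, §1 pp. 240–241] [cite: BruhatTits1972, §10] [cite: Jacobowitz1962, §4] -/
theorem comap_planeMatrix_mem_tokenConeIndex [IsPrincipalIdealRing 𝒪[K]] (σ : K →+* K) (hσ : ∀ a, σ (σ a) = a)
    (hvσ : ∀ a, Valued.v (σ a) = Valued.v a) {ϖ : K} (hϖ : Valued.v ϖ = WithZero.exp (-1 : ℤ))
    {H₂ : Matrix (Fin 2) (Fin 2) K} (hH₂ : IsUnit H₂.det) (hH₂σ : (H₂.map σ)ᵀ = H₂) {h : K} (hh : Valued.v h = 1)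
    {M : Submodule 𝒪[K] (Fin 3 → K)} (hM : IsSelfDualLattice σ ϖ (!![H₂ 0 0, 0, H₂ 0 1; 0, h, 0; H₂ 1 0, 0, H₂ 1 1] : Matrix (Fin 3) (Fin 3) K) M)
    {b : ℕ} (hb1 : 1 ≤ b) (hb : ∀ a : K, (Pi.single 1 a : Fin 3 → K) ∈ M ↔ Valued.v a ≤ Valued.v ϖ ^ b)
    (γ₂ : GL (Fin 2) K) (u : GL (Fin 1) K) (hΓ : endoGL (γ₂, u) ∈ unitaryGroupOfForm σ (!![H₂ 0 0, 0, H₂ 0 1; 0, h, 0; H₂ 1 0, 0, H₂ 1 1] : Matrix (Fin 3) (Fin 3) K))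
    (hu : Valued.v ((u : Matrix (Fin 1) (Fin 1) K) 0 0) = 1) {X : Matrix (Fin 3) (Fin 3) K} (hcol : ∀ l, l ≠ 1 → X l 1 = 0) (hrow : ∀ l, l ≠ 1 → X 1 l = 0)
    {c : K} (hc : c ≠ 0) (hfix : mapGL (endoGL (γ₂, u)) M = M) (htok : ∀ x ∈ M, X *ᵥ x ∈ scaleLattice c M) :
    (M ⊓ LinearMap.ker ((LinearMap.proj (1 : Fin 3) : (Fin 3 → K) →ₗ[K] K).restrictScalars 𝒪[K])).comap
        ((Matrix.toLin' (!![1, 0; 0, 0; 0, 1] : Matrix (Fin 3) (Fin 2) K)).restrictScalars 𝒪[K]) ∈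
      {B : Submodule 𝒪[K] (Fin 2 → K) | (∃ g : GL (Fin 2) K, B = latt (g : Matrix (Fin 2) (Fin 2) K)) ∧ mapGL γ₂ B = B ∧
          (∀ y ∈ B, c⁻¹ • ((!![X 0 0, X 0 2; X 2 0, X 2 2] : Matrix (Fin 2) (Fin 2) K) *ᵥ y) ∈ B) ∧
          ∃ w₀ : Fin 2 → K, (∀ w, w ∈ B ↔ (w ∈ dualLatt σ H₂ B ∧ Valued.v (pairing σ H₂ w₀ w) ≤ 1)) ∧
            (∀ w ∈ dualLatt σ H₂ B, ∃ (t : K) (a : Fin 2 → K), Valued.v t ≤ 1 ∧ a ∈ B ∧ w = t • w₀ + a) ∧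
            Valued.v (pairing σ H₂ w₀ w₀) * Valued.v ϖ ^ (2 * b) = 1 ∧
            (γ₂ : Matrix (Fin 2) (Fin 2) K).mulVec w₀ - (u : Matrix (Fin 1) (Fin 1) K) 0 0 • w₀ ∈ B ∧
            c⁻¹ • ((!![X 0 0, X 0 2; X 2 0, X 2 2] : Matrix (Fin 2) (Fin 2) K) *ᵥ w₀ - X 1 1 • w₀) ∈ B} := by
  obtain ⟨B₂, w₀, x₀, hg, hB, hx₀, hx₀1, hpr, hG1, hgen, hnorm⟩ := exists_planeGlueData σ hσ hvσ hϖ hH₂ hH₂σ hh hM hb1 hb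
  have hcomap : (M ⊓ LinearMap.ker ((LinearMap.proj (1 : Fin 3) : (Fin 3 → K) →ₗ[K] K).restrictScalars 𝒪[K])).comap
      ((Matrix.toLin' (!![1, 0; 0, 0; 0, 1] : Matrix (Fin 3) (Fin 2) K)).restrictScalars 𝒪[K]) = B₂ := by
    rw [← hB, Submodule.comap_map_eq_of_injective planeMatrix_injective]
  obtain ⟨hγB, hplain⟩ := (mapGL_endoGL_eq_iff_plane σ hvσ hϖ hH₂ hh hM hb1 hb hg hB hx₀ hx₀1 hpr γ₂ u hΓ hu).1 hfix
  obtain ⟨b', hb', hslope, -⟩ := exists_tubeCoordinate σ hvσ hϖ hH₂ hh hM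
  obtain ⟨hbb, -⟩ := tubeCoordinate_unique hϖ hb hb'
  subst hbb
  obtain ⟨-, hW, hdeep⟩ := (forall_mulVec_mem_scaleLattice_iff_plane hϖ hcol hrow hc hb hslope hB hx₀ hx₀1 hpr).1 htok
  rw [hcomap]
  exact ⟨hg, hγB, hW, w₀, hG1, hgen, hnorm, hplain, hdeep⟩

/-- **(L6-X)** If `M` is self-dual with tube coordinate `b ≥ 1`, `ι_W⁻¹(M ∩ W) ∈ S_b^{X,c}` and the guard `|X₁₁| ≤ |c|` holds, then `Γ·M = M` and `X·M ⊆ c·M` (fixedness by ★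
(L6) from the plain clause; the token by ★ p857479 §2 glue data, ★ `sub_smul_mem_iff_of_related` at `(c⁻¹X_W, c⁻¹X₁₁)` for the representative, ★ (E1)).
[cite: Kottwitz1986BaseChangeUnits, §1 pp. 240–241] [cite: BruhatTits1972, §10] [cite: Jacobowitz1962, §4] -/
theorem mapGL_eq_and_token_of_comap_planeMatrix_mem_tokenConeIndex [IsPrincipalIdealRing 𝒪[K]] (σ : K →+* K) (hσ : ∀ a, σ (σ a) = a)
    (hvσ : ∀ a, Valued.v (σ a) = Valued.v a) {ϖ : K} (hϖ : Valued.v ϖ = WithZero.exp (-1 : ℤ))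
    {H₂ : Matrix (Fin 2) (Fin 2) K} (hH₂ : IsUnit H₂.det) (hH₂σ : (H₂.map σ)ᵀ = H₂) {h : K} (hh : Valued.v h = 1)
    {M : Submodule 𝒪[K] (Fin 3 → K)} (hM : IsSelfDualLattice σ ϖ (!![H₂ 0 0, 0, H₂ 0 1; 0, h, 0; H₂ 1 0, 0, H₂ 1 1] : Matrix (Fin 3) (Fin 3) K) M)
    {b : ℕ} (hb1 : 1 ≤ b) (hb : ∀ a : K, (Pi.single 1 a : Fin 3 → K) ∈ M ↔ Valued.v a ≤ Valued.v ϖ ^ b)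
    (γ₂ : GL (Fin 2) K) (u : GL (Fin 1) K) (hΓ : endoGL (γ₂, u) ∈ unitaryGroupOfForm σ (!![H₂ 0 0, 0, H₂ 0 1; 0, h, 0; H₂ 1 0, 0, H₂ 1 1] : Matrix (Fin 3) (Fin 3) K))
    (hu : Valued.v ((u : Matrix (Fin 1) (Fin 1) K) 0 0) = 1) {X : Matrix (Fin 3) (Fin 3) K} (hcol : ∀ l, l ≠ 1 → X l 1 = 0) (hrow : ∀ l, l ≠ 1 → X 1 l = 0)
    {c : K} (hc : c ≠ 0) (hXc : Valued.v (X 1 1) ≤ Valued.v c)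
    (hS : (M ⊓ LinearMap.ker ((LinearMap.proj (1 : Fin 3) : (Fin 3 → K) →ₗ[K] K).restrictScalars 𝒪[K])).comap
        ((Matrix.toLin' (!![1, 0; 0, 0; 0, 1] : Matrix (Fin 3) (Fin 2) K)).restrictScalars 𝒪[K]) ∈
      {B : Submodule 𝒪[K] (Fin 2 → K) | (∃ g : GL (Fin 2) K, B = latt (g : Matrix (Fin 2) (Fin 2) K)) ∧ mapGL γ₂ B = B ∧
          (∀ y ∈ B, c⁻¹ • ((!![X 0 0, X 0 2; X 2 0, X 2 2] : Matrix (Fin 2) (Fin 2) K) *ᵥ y) ∈ B) ∧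
          ∃ w₀ : Fin 2 → K, (∀ w, w ∈ B ↔ (w ∈ dualLatt σ H₂ B ∧ Valued.v (pairing σ H₂ w₀ w) ≤ 1)) ∧
            (∀ w ∈ dualLatt σ H₂ B, ∃ (t : K) (a : Fin 2 → K), Valued.v t ≤ 1 ∧ a ∈ B ∧ w = t • w₀ + a) ∧
            Valued.v (pairing σ H₂ w₀ w₀) * Valued.v ϖ ^ (2 * b) = 1 ∧
            (γ₂ : Matrix (Fin 2) (Fin 2) K).mulVec w₀ - (u : Matrix (Fin 1) (Fin 1) K) 0 0 • w₀ ∈ B ∧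
            c⁻¹ • ((!![X 0 0, X 0 2; X 2 0, X 2 2] : Matrix (Fin 2) (Fin 2) K) *ᵥ w₀ - X 1 1 • w₀) ∈ B}) :
    mapGL (endoGL (γ₂, u)) M = M ∧ ∀ x ∈ M, X *ᵥ x ∈ scaleLattice c M := by
  obtain ⟨B₂, w₀', x₀, hg, hB, hx₀, hx₀1, hpr, hG1', hgen', -⟩ := exists_planeGlueData σ hσ hvσ hϖ hH₂ hH₂σ hh hM hb1 hb
  have hcomap : (M ⊓ LinearMap.ker ((LinearMap.proj (1 : Fin 3) : (Fin 3 → K) →ₗ[K] K).restrictScalars 𝒪[K])).comap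
      ((Matrix.toLin' (!![1, 0; 0, 0; 0, 1] : Matrix (Fin 3) (Fin 2) K)).restrictScalars 𝒪[K]) = B₂ := by
    rw [← hB, Submodule.comap_map_eq_of_injective planeMatrix_injective]
  rw [hcomap] at hS
  obtain ⟨hg'', hγB, hW, w₀, hG1, hgen, hnorm, hplain, hdeep⟩ := hS
  have hSb : (M ⊓ LinearMap.ker ((LinearMap.proj (1 : Fin 3) : (Fin 3 → K) →ₗ[K] K).restrictScalars 𝒪[K])).comap
        ((Matrix.toLin' (!![1, 0; 0, 0; 0, 1] : Matrix (Fin 3) (Fin 2) K)).restrictScalars 𝒪[K]) ∈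
      {B : Submodule 𝒪[K] (Fin 2 → K) | (∃ g : GL (Fin 2) K, B = latt (g : Matrix (Fin 2) (Fin 2) K)) ∧ mapGL γ₂ B = B ∧
          ∃ w₀ : Fin 2 → K, (∀ w, w ∈ B ↔ (w ∈ dualLatt σ H₂ B ∧ Valued.v (pairing σ H₂ w₀ w) ≤ 1)) ∧
            (∀ w ∈ dualLatt σ H₂ B, ∃ (t : K) (a : Fin 2 → K), Valued.v t ≤ 1 ∧ a ∈ B ∧ w = t • w₀ + a) ∧
            Valued.v (pairing σ H₂ w₀ w₀) * Valued.v ϖ ^ (2 * b) = 1 ∧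
            (γ₂ : Matrix (Fin 2) (Fin 2) K).mulVec w₀ - (u : Matrix (Fin 1) (Fin 1) K) 0 0 • w₀ ∈ B} := by
    rw [hcomap]
    exact ⟨hg'', hγB, w₀, hG1, hgen, hnorm, hplain⟩
  refine ⟨mapGL_eq_of_comap_planeMatrix_mem_coneIndex σ hσ hvσ hϖ hH₂ hH₂σ hh hM hb1 hb γ₂ u hΓ hu hSb, ?_⟩
  -- the token: move the deep clause to `M`'s own representative `w₀'`, then ★ (E1)
  have hH₂h : ∀ a d : Fin 2, σ (H₂ a d) = H₂ d a := fun a d => by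
    have e := congrFun (congrFun hH₂σ d) a
    rwa [Matrix.transpose_apply, Matrix.map_apply] at e
  have hsymm₂ : ∀ x y : Fin 2 → K, Valued.v (pairing σ H₂ y x) = Valued.v (pairing σ H₂ x y) := v_pairing_comm_of_hermitian hvσ hσ hH₂h
  have hw₀'d : w₀' ∈ dualLatt σ H₂ B₂ := fun y hy => by rw [hsymm₂]; exact ((hG1' y).1 hy).2
  have hw₀d : w₀ ∈ dualLatt σ H₂ B₂ := fun y hy => by rw [hsymm₂]; exact ((hG1 y).1 hy).2
  have hst' : ∀ y ∈ B₂, (c⁻¹ • (!![X 0 0, X 0 2; X 2 0, X 2 2] : Matrix (Fin 2) (Fin 2) K)) *ᵥ y ∈ B₂ := fun y hy => by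
    rw [Matrix.smul_mulVec]; exact hW y hy
  have hu' : Valued.v (c⁻¹ * X 1 1) ≤ 1 := by
    have hvc : 0 < Valued.v c := zero_lt_iff.2 ((Valuation.ne_zero_iff _).2 hc)
    rw [map_mul, map_inv₀, ← div_eq_inv_mul, div_le_one₀ hvc]; exact hXc
  have e : ∀ w : Fin 2 → K, (c⁻¹ • (!![X 0 0, X 0 2; X 2 0, X 2 2] : Matrix (Fin 2) (Fin 2) K)) *ᵥ w - (c⁻¹ * X 1 1) • w =
      c⁻¹ • ((!![X 0 0, X 0 2; X 2 0, X 2 2] : Matrix (Fin 2) (Fin 2) K) *ᵥ w - X 1 1 • w) := fun w => by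
    rw [Matrix.smul_mulVec, mul_smul, ← smul_sub]
  have hdeep' : c⁻¹ • ((!![X 0 0, X 0 2; X 2 0, X 2 2] : Matrix (Fin 2) (Fin 2) K) *ᵥ w₀' - X 1 1 • w₀') ∈ B₂ := by
    have h1 := (sub_smul_mem_iff_of_related hst' hu' (hgen _ hw₀'d) (hgen' _ hw₀d)).1 (by rw [e]; exact hdeep)
    rwa [e] at h1
  obtain ⟨b', hb', hslope, -⟩ := exists_tubeCoordinate σ hvσ hϖ hH₂ hh hM
  obtain ⟨hbb, -⟩ := tubeCoordinate_unique hϖ hb hb'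
  subst hbb
  exact (forall_mulVec_mem_scaleLattice_iff_plane hϖ hcol hrow hc hb hslope hB hx₀ hx₀1 hpr).2 ⟨hXc, hW, hdeep'⟩

/-! ## §2 The tube layer `b ≥ 1` with a generic token -/

/-- **LAYER COUNT WITH A GENERIC TOKEN** (`Γ` unitary with finite fixed family; `X` block at `1`; `c ≠ 0`, guard `|X₁₁| ≤ |c|`; `b ≥ 1`):
`Σᶠ_B #{M ∣ SD, Γ·M = M, X·M ⊆ c·M, tube b, M ∩ W = B} = Σᶠ_{B₂ ∈ S_b^{X,c}} #{M ∣ SD, M ∩ W = ι_W B₂, tube b}`. [cite: BruhatTits1972, §10] [cite: Kottwitz1986BaseChangeUnits, §1 pp. 240–241] [cite: Jacobowitz1962, §4] -/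
theorem finsum_ncard_tokenGlueCell_eq_finsum_mem_ncard_glueFibre [IsPrincipalIdealRing 𝒪[K]] (σ : K →+* K) (hσ : ∀ a, σ (σ a) = a)
    (hvσ : ∀ a, Valued.v (σ a) = Valued.v a) {ϖ : K} (hϖ : Valued.v ϖ = WithZero.exp (-1 : ℤ))
    {H₂ : Matrix (Fin 2) (Fin 2) K} (hH₂ : IsUnit H₂.det) (hH₂σ : (H₂.map σ)ᵀ = H₂) {h : K} (hh : Valued.v h = 1)
    (γ₂ : GL (Fin 2) K) (u : GL (Fin 1) K) (hΓ : endoGL (γ₂, u) ∈ unitaryGroupOfForm σ (!![H₂ 0 0, 0, H₂ 0 1; 0, h, 0; H₂ 1 0, 0, H₂ 1 1] : Matrix (Fin 3) (Fin 3) K))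
    (hu : Valued.v ((u : Matrix (Fin 1) (Fin 1) K) 0 0) = 1) {X : Matrix (Fin 3) (Fin 3) K} (hcol : ∀ l, l ≠ 1 → X l 1 = 0) (hrow : ∀ l, l ≠ 1 → X 1 l = 0)
    {c : K} (hc : c ≠ 0) (hXc : Valued.v (X 1 1) ≤ Valued.v c)
    (hfin : {M : Submodule 𝒪[K] (Fin 3 → K) |
      IsSelfDualLattice σ ϖ (!![H₂ 0 0, 0, H₂ 0 1; 0, h, 0; H₂ 1 0, 0, H₂ 1 1] : Matrix (Fin 3) (Fin 3) K) M ∧ mapGL (endoGL (γ₂, u)) M = M}.Finite)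
    {b : ℕ} (hb1 : 1 ≤ b) :
    ∑ᶠ B : Submodule 𝒪[K] (Fin 3 → K),
        {M : Submodule 𝒪[K] (Fin 3 → K) |
          (IsSelfDualLattice σ ϖ (!![H₂ 0 0, 0, H₂ 0 1; 0, h, 0; H₂ 1 0, 0, H₂ 1 1] : Matrix (Fin 3) (Fin 3) K) M ∧
              (mapGL (endoGL (γ₂, u)) M = M ∧ ∀ x ∈ M, X *ᵥ x ∈ scaleLattice c M)) ∧
            (∀ a : K, (Pi.single 1 a : Fin 3 → K) ∈ M ↔ Valued.v a ≤ Valued.v ϖ ^ b) ∧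
            M ⊓ LinearMap.ker ((LinearMap.proj (1 : Fin 3) : (Fin 3 → K) →ₗ[K] K).restrictScalars 𝒪[K]) = B}.ncard =
      ∑ᶠ B₂ ∈ {B : Submodule 𝒪[K] (Fin 2 → K) | (∃ g : GL (Fin 2) K, B = latt (g : Matrix (Fin 2) (Fin 2) K)) ∧ mapGL γ₂ B = B ∧
          (∀ y ∈ B, c⁻¹ • ((!![X 0 0, X 0 2; X 2 0, X 2 2] : Matrix (Fin 2) (Fin 2) K) *ᵥ y) ∈ B) ∧
          ∃ w₀ : Fin 2 → K, (∀ w, w ∈ B ↔ (w ∈ dualLatt σ H₂ B ∧ Valued.v (pairing σ H₂ w₀ w) ≤ 1)) ∧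
            (∀ w ∈ dualLatt σ H₂ B, ∃ (t : K) (a : Fin 2 → K), Valued.v t ≤ 1 ∧ a ∈ B ∧ w = t • w₀ + a) ∧
            Valued.v (pairing σ H₂ w₀ w₀) * Valued.v ϖ ^ (2 * b) = 1 ∧
            (γ₂ : Matrix (Fin 2) (Fin 2) K).mulVec w₀ - (u : Matrix (Fin 1) (Fin 1) K) 0 0 • w₀ ∈ B ∧
            c⁻¹ • ((!![X 0 0, X 0 2; X 2 0, X 2 2] : Matrix (Fin 2) (Fin 2) K) *ᵥ w₀ - X 1 1 • w₀) ∈ B},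
        {M : Submodule 𝒪[K] (Fin 3 → K) | IsSelfDualLattice σ ϖ (!![H₂ 0 0, 0, H₂ 0 1; 0, h, 0; H₂ 1 0, 0, H₂ 1 1] : Matrix (Fin 3) (Fin 3) K) M ∧
            M ⊓ LinearMap.ker ((LinearMap.proj (1 : Fin 3) : (Fin 3 → K) →ₗ[K] K).restrictScalars 𝒪[K]) =
              B₂.map ((Matrix.toLin' (!![1, 0; 0, 0; 0, 1] : Matrix (Fin 3) (Fin 2) K)).restrictScalars 𝒪[K]) ∧
            ∀ a : K, (Pi.single 1 a : Fin 3 → K) ∈ M ↔ Valued.v a ≤ Valued.v ϖ ^ b}.ncard := by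
  classical
  set H : Matrix (Fin 3) (Fin 3) K := !![H₂ 0 0, 0, H₂ 0 1; 0, h, 0; H₂ 1 0, 0, H₂ 1 1] with hHdef
  set Wk : Submodule 𝒪[K] (Fin 3 → K) := LinearMap.ker ((LinearMap.proj (1 : Fin 3) : (Fin 3 → K) →ₗ[K] K).restrictScalars 𝒪[K]) with hWk
  set ι := ((Matrix.toLin' (!![1, 0; 0, 0; 0, 1] : Matrix (Fin 3) (Fin 2) K)).restrictScalars 𝒪[K]) with hι
  set S : Set (Submodule 𝒪[K] (Fin 2 → K)) := {B : Submodule 𝒪[K] (Fin 2 → K) | (∃ g : GL (Fin 2) K, B = latt (g : Matrix (Fin 2) (Fin 2) K)) ∧ mapGL γ₂ B = B ∧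
          (∀ y ∈ B, c⁻¹ • ((!![X 0 0, X 0 2; X 2 0, X 2 2] : Matrix (Fin 2) (Fin 2) K) *ᵥ y) ∈ B) ∧
          ∃ w₀ : Fin 2 → K, (∀ w, w ∈ B ↔ (w ∈ dualLatt σ H₂ B ∧ Valued.v (pairing σ H₂ w₀ w) ≤ 1)) ∧
            (∀ w ∈ dualLatt σ H₂ B, ∃ (t : K) (a : Fin 2 → K), Valued.v t ≤ 1 ∧ a ∈ B ∧ w = t • w₀ + a) ∧
            Valued.v (pairing σ H₂ w₀ w₀) * Valued.v ϖ ^ (2 * b) = 1 ∧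
            (γ₂ : Matrix (Fin 2) (Fin 2) K).mulVec w₀ - (u : Matrix (Fin 1) (Fin 1) K) 0 0 • w₀ ∈ B ∧
            c⁻¹ • ((!![X 0 0, X 0 2; X 2 0, X 2 2] : Matrix (Fin 2) (Fin 2) K) *ᵥ w₀ - X 1 1 • w₀) ∈ B} with hSdef
  set L : Set (Submodule 𝒪[K] (Fin 3 → K)) := {M | (IsSelfDualLattice σ ϖ H M ∧
      (mapGL (endoGL (γ₂, u)) M = M ∧ ∀ x ∈ M, X *ᵥ x ∈ scaleLattice c M)) ∧
      ∀ a : K, (Pi.single 1 a : Fin 3 → K) ∈ M ↔ Valued.v a ≤ Valued.v ϖ ^ b} with hL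
  have hLfin : L.Finite := hfin.subset fun M hM => ⟨hM.1.1, hM.1.2.1⟩
  have h1 : (∑ᶠ B : Submodule 𝒪[K] (Fin 3 → K), {M : Submodule 𝒪[K] (Fin 3 → K) | (IsSelfDualLattice σ ϖ H M ∧
      (mapGL (endoGL (γ₂, u)) M = M ∧ ∀ x ∈ M, X *ᵥ x ∈ scaleLattice c M)) ∧
      (∀ a : K, (Pi.single 1 a : Fin 3 → K) ∈ M ↔ Valued.v a ≤ Valued.v ϖ ^ b) ∧ M ⊓ Wk = B}.ncard) = L.ncard := by
    rw [ncard_eq_finsum_ncard_fiber L hLfin fun M => M ⊓ Wk]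
    refine finsum_congr fun B => ?_
    congr 1
    ext M
    simp only [hL, Set.mem_setOf_eq, and_assoc]
  rw [h1, ncard_eq_finsum_ncard_fiber L hLfin fun M => (M ⊓ Wk).comap ι, finsum_mem_def]
  refine finsum_congr fun B₂ => ?_
  by_cases hS : B₂ ∈ S
  · rw [Set.indicator_of_mem hS]
    congr 1
    ext M
    simp only [hL, Set.mem_setOf_eq]
    constructor
    · rintro ⟨⟨⟨hSD, -⟩, htube⟩, hκ⟩
      refine ⟨hSD, ?_, htube⟩
      rw [← hκ, map_comap_planeMatrix_inf_ker]
    · rintro ⟨hSD, hW, htube⟩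
      have hκ : (M ⊓ Wk).comap ι = B₂ := by rw [hW, Submodule.comap_map_eq_of_injective planeMatrix_injective]
      have hS' := hS
      rw [← hκ] at hS'
      exact ⟨⟨⟨hSD, mapGL_eq_and_token_of_comap_planeMatrix_mem_tokenConeIndex σ hσ hvσ hϖ hH₂ hH₂σ hh hSD hb1 htube γ₂ u hΓ hu hcol hrow hc hXc hS'⟩, htube⟩, hκ⟩
  · rw [Set.indicator_of_notMem hS]
    have hempty : {M : Submodule 𝒪[K] (Fin 3 → K) | M ∈ L ∧ (M ⊓ Wk).comap ι = B₂} = ∅ := by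
      ext M
      simp only [hL, Set.mem_setOf_eq, Set.mem_empty_iff_false, iff_false]
      rintro ⟨⟨⟨hSD, hfix, htok⟩, htube⟩, hκ⟩
      have hmem := comap_planeMatrix_mem_tokenConeIndex σ hσ hvσ hϖ hH₂ hH₂σ hh hSD hb1 htube γ₂ u hΓ hu hcol hrow hc hfix htok
      rw [hκ] at hmem
      exact hS hmem
    rw [hempty, Set.ncard_empty]

/-! ## §3 HEAD — the fixed self-dual lattices WITH A GENERIC BLOCK TOKEN, counted through the plane -/

/-- **(C1-P^X) PART 1 — O-GLUE COUNT WITH A GENERIC BLOCK TOKEN (HEAD).**  Block form `H` (`σ` an isometric involution, `H₂` hermitian with unit determinant, `|h| = 1`, `𝒪`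
a PID), `Γ = endoGL (γ₂, u)` UNITARY with finite fixed self-dual family of tube coordinates `≤ R`; `X` block at `1`, `c ≠ 0`, guard `|X₁₁| ≤ |c|`.  Then
`#{M ∣ SD, Γ·M = M, M.map X ≤ c·M} = #{B₂ ∣ SD_W, γ₂B₂ = B₂, B₂.map X_W ≤ c·B₂} + Σ_{b ∈ [1, R]} Σᶠ_{B₂ ∈ S_b^{X,c}} #{M ∣ SD, M ∩ W = ι_W B₂, tube b}`
— ★ p857312 (general side condition) ⊕ ★ (z1-d) `ncard_selfDual_fixed_axis_eq` with the token label (§0) ⊕ §2.  ★ p858811 is the instance `X = Γ − 1` (up to the plain clause,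
which the depth token implies); `X = (Γ − 1)²` is the square token of the pieces `sqLevel_b` ∕ `f_reg`. [cite: Kottwitz1986BaseChangeUnits, §1 pp. 240–241] [cite: BruhatTits1972, §10] [cite: Jacobowitz1962, §4] [cite: Rogawski1990, §4.9 p. 55] -/
theorem ncard_fixed_selfDual_endoGL_token_eq_axis_add_sum [IsPrincipalIdealRing 𝒪[K]] (σ : K →+* K) (hσ : ∀ a, σ (σ a) = a)
    (hvσ : ∀ a, Valued.v (σ a) = Valued.v a) {ϖ : K} (hϖ : Valued.v ϖ = WithZero.exp (-1 : ℤ))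
    {H₂ : Matrix (Fin 2) (Fin 2) K} (hH₂ : IsUnit H₂.det) (hH₂σ : (H₂.map σ)ᵀ = H₂) {h : K} (hh : Valued.v h = 1)
    (γ₂ : GL (Fin 2) K) (u : GL (Fin 1) K) (hΓ : endoGL (γ₂, u) ∈ unitaryGroupOfForm σ (!![H₂ 0 0, 0, H₂ 0 1; 0, h, 0; H₂ 1 0, 0, H₂ 1 1] : Matrix (Fin 3) (Fin 3) K))
    (hu : Valued.v ((u : Matrix (Fin 1) (Fin 1) K) 0 0) = 1) {X : Matrix (Fin 3) (Fin 3) K} (hcol : ∀ l, l ≠ 1 → X l 1 = 0) (hrow : ∀ l, l ≠ 1 → X 1 l = 0)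
    {c : K} (hc : c ≠ 0) (hXc : Valued.v (X 1 1) ≤ Valued.v c) {R : ℕ}
    (hfin : {M : Submodule 𝒪[K] (Fin 3 → K) |
      IsSelfDualLattice σ ϖ (!![H₂ 0 0, 0, H₂ 0 1; 0, h, 0; H₂ 1 0, 0, H₂ 1 1] : Matrix (Fin 3) (Fin 3) K) M ∧ mapGL (endoGL (γ₂, u)) M = M}.Finite)
    (hR : ∀ M : Submodule 𝒪[K] (Fin 3 → K), IsSelfDualLattice σ ϖ (!![H₂ 0 0, 0, H₂ 0 1; 0, h, 0; H₂ 1 0, 0, H₂ 1 1] : Matrix (Fin 3) (Fin 3) K) M →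
      mapGL (endoGL (γ₂, u)) M = M → ∀ b : ℕ, (∀ a : K, (Pi.single 1 a : Fin 3 → K) ∈ M ↔ Valued.v a ≤ Valued.v ϖ ^ b) → b ≤ R) :
    {M : Submodule 𝒪[K] (Fin 3 → K) |
        IsSelfDualLattice σ ϖ (!![H₂ 0 0, 0, H₂ 0 1; 0, h, 0; H₂ 1 0, 0, H₂ 1 1] : Matrix (Fin 3) (Fin 3) K) M ∧ mapGL (endoGL (γ₂, u)) M = M ∧
          M.map ((Matrix.toLin' X).restrictScalars 𝒪[K]) ≤ scaleLattice c M}.ncard =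
      {B₂ : Submodule 𝒪[K] (Fin 2 → K) | IsSelfDualLattice σ ϖ H₂ B₂ ∧ mapGL γ₂ B₂ = B₂ ∧
          B₂.map ((Matrix.toLin' (!![X 0 0, X 0 2; X 2 0, X 2 2] : Matrix (Fin 2) (Fin 2) K)).restrictScalars 𝒪[K]) ≤ scaleLattice c B₂}.ncard +
        ∑ b ∈ Finset.Icc 1 R, ∑ᶠ B₂ ∈ {B : Submodule 𝒪[K] (Fin 2 → K) | (∃ g : GL (Fin 2) K, B = latt (g : Matrix (Fin 2) (Fin 2) K)) ∧ mapGL γ₂ B = B ∧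
            (∀ y ∈ B, c⁻¹ • ((!![X 0 0, X 0 2; X 2 0, X 2 2] : Matrix (Fin 2) (Fin 2) K) *ᵥ y) ∈ B) ∧
            ∃ w₀ : Fin 2 → K, (∀ w, w ∈ B ↔ (w ∈ dualLatt σ H₂ B ∧ Valued.v (pairing σ H₂ w₀ w) ≤ 1)) ∧
              (∀ w ∈ dualLatt σ H₂ B, ∃ (t : K) (a : Fin 2 → K), Valued.v t ≤ 1 ∧ a ∈ B ∧ w = t • w₀ + a) ∧
              Valued.v (pairing σ H₂ w₀ w₀) * Valued.v ϖ ^ (2 * b) = 1 ∧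
              (γ₂ : Matrix (Fin 2) (Fin 2) K).mulVec w₀ - (u : Matrix (Fin 1) (Fin 1) K) 0 0 • w₀ ∈ B ∧
              c⁻¹ • ((!![X 0 0, X 0 2; X 2 0, X 2 2] : Matrix (Fin 2) (Fin 2) K) *ᵥ w₀ - X 1 1 • w₀) ∈ B},
          {M : Submodule 𝒪[K] (Fin 3 → K) | IsSelfDualLattice σ ϖ (!![H₂ 0 0, 0, H₂ 0 1; 0, h, 0; H₂ 1 0, 0, H₂ 1 1] : Matrix (Fin 3) (Fin 3) K) M ∧
              M ⊓ LinearMap.ker ((LinearMap.proj (1 : Fin 3) : (Fin 3 → K) →ₗ[K] K).restrictScalars 𝒪[K]) =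
                B₂.map ((Matrix.toLin' (!![1, 0; 0, 0; 0, 1] : Matrix (Fin 3) (Fin 2) K)).restrictScalars 𝒪[K]) ∧
              ∀ a : K, (Pi.single 1 a : Fin 3 → K) ∈ M ↔ Valued.v a ≤ Valued.v ϖ ^ b}.ncard := by
  classical
  have hϖv0 : Valued.v ϖ ≠ 0 := by rw [hϖ]; exact WithZero.coe_ne_zero
  have hϖ0 : ϖ ≠ 0 := fun h0 => hϖv0 (by rw [h0, map_zero])
  have hϖ1 : Valued.v ϖ ≤ 1 := by rw [hϖ, ← WithZero.exp_zero, WithZero.exp_le_exp]; norm_num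
  set P : Submodule 𝒪[K] (Fin 3 → K) → Prop := fun M =>
    mapGL (endoGL (γ₂, u)) M = M ∧ ∀ x ∈ M, X *ᵥ x ∈ scaleLattice c M with hP
  have hLHS : {M : Submodule 𝒪[K] (Fin 3 → K) |
        IsSelfDualLattice σ ϖ (!![H₂ 0 0, 0, H₂ 0 1; 0, h, 0; H₂ 1 0, 0, H₂ 1 1] : Matrix (Fin 3) (Fin 3) K) M ∧ mapGL (endoGL (γ₂, u)) M = M ∧
          M.map ((Matrix.toLin' X).restrictScalars 𝒪[K]) ≤ scaleLattice c M} =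
      {M | IsSelfDualLattice σ ϖ (!![H₂ 0 0, 0, H₂ 0 1; 0, h, 0; H₂ 1 0, 0, H₂ 1 1] : Matrix (Fin 3) (Fin 3) K) M ∧ P M} := by
    ext M; simp only [Set.mem_setOf_eq, hP, map_toLin'_le_scaleLattice_iff_forall_mulVec_mem]
  have hfinP : {M : Submodule 𝒪[K] (Fin 3 → K) |
      IsSelfDualLattice σ ϖ (!![H₂ 0 0, 0, H₂ 0 1; 0, h, 0; H₂ 1 0, 0, H₂ 1 1] : Matrix (Fin 3) (Fin 3) K) M ∧ P M}.Finite :=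
    hfin.subset fun M hM => ⟨hM.1, hM.2.1⟩
  have hRP : ∀ M : Submodule 𝒪[K] (Fin 3 → K), IsSelfDualLattice σ ϖ (!![H₂ 0 0, 0, H₂ 0 1; 0, h, 0; H₂ 1 0, 0, H₂ 1 1] : Matrix (Fin 3) (Fin 3) K) M → P M →
      ∀ b : ℕ, (∀ a : K, (Pi.single 1 a : Fin 3 → K) ∈ M ↔ Valued.v a ≤ Valued.v ϖ ^ b) → b ≤ R := fun M hM hPM => hR M hM hPM.1
  rw [hLHS, ncard_selfDual_eq_ncard_axis_add_sum_finsum_ncard_glueFibre σ hvσ hϖ hH₂ hh P hfinP hRP]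
  congr 1
  · -- the axis: ★ (z1-d) with the token label (§0 reads it on `latt ι(g₂, 1)`)
    have hax := ncard_selfDual_fixed_axis_eq σ hvσ hϖ0 hϖ1 hH₂ hh γ₂ hu
      (fun M => M.map ((Matrix.toLin' X).restrictScalars 𝒪[K]) ≤ scaleLattice c M)
      (fun B => B.map ((Matrix.toLin' (!![X 0 0, X 0 2; X 2 0, X 2 2] : Matrix (Fin 2) (Fin 2) K)).restrictScalars 𝒪[K]) ≤ scaleLattice c B)
      (fun g₂ => by rw [map_block_latt_endoGL_le_scaleLattice_iff hc g₂ hcol hrow]; exact ⟨fun H => H.1, fun H => ⟨H, hXc⟩⟩)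
    rw [← hax]
    congr 1
    ext M
    simp only [Set.mem_setOf_eq, hP, map_toLin'_le_scaleLattice_iff_forall_mulVec_mem]
    tauto
  · refine Finset.sum_congr rfl fun b hb => ?_
    have h := finsum_ncard_tokenGlueCell_eq_finsum_mem_ncard_glueFibre σ hσ hvσ hϖ hH₂ hH₂σ hh γ₂ u hΓ hu hcol hrow hc hXc hfin (Finset.mem_Icc.1 hb).1
    simp only [hP]
    exact h

end Summit.HodgeConjecture.HodgeConjecture.Cruxes.H413.F0P3cDyRamBlockGlueTokenCount

end
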